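import Summits.QuantumFields.YangMills.Theorems.LuscherReductionDressedRitzLiftLeakageResidual
import Mathlib.Analysis.Complex.Exponential
import HarnessLib

/-!
# Crux `DressedRitz` (stmt-QuantumFields-20205), line «polyakovlift» r5, stub S-LEAK `stub_liftLeakage` — support XXI-a:
# Rayleigh-quotient bookkeeping for the width slot (CW): residual laws at the Rayleigh quotient; Rayleigh gaps from ratio universality

Support module (fleet seat ym-20205-polyakovlift-s1 gen 1; `--supports stmt-QuantumFields-20205`, helper, no closure claim).  Lemmas for XXI-b
(`…LiftLeakageWidthFree.lean`), which discharges the fine-theory part of the width slot (CW) of S-LEAK's located core by the registered neighbour stub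
S-UNIV′ (`ChannelUniversalityAt`, clause (A5): the Rayleigh quotient of every dressed channel vector equals `λ₀/μ₀` times its one-site shadow's, to `e^{±Cλ²/L}`):

* `residual_at_rayleigh_le` — a residual law `‖(K_β − a)v‖² ≤ ρ‖v‖²` at ANY `a` implies the one at the Rayleigh quotient `a = ⟨v,K_βv⟩/‖v‖²` (same `ρ`;
  the Rayleigh quotient minimises the residual; null vectors included);
* `ratio_gap_le` — real-number lemma: from the (A5) pair «upper for `i`, lower for `i′`», `E ≥ 1`, `R^o_i ≤ m₀`:
  `R^f_i − R^f_{i′} ≤ l₀(E − E⁻¹) + (l₀/m₀)|R^o_i − R^o_{i′}|`;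
* `ratio_forms_of_products` — product ⟹ ratio forms of the (A5) pair; `exp_sub_exp_neg_le_four_mul` — `e^y − e^{−y} ≤ 4y` on `[0,1]`;
* ★ `rayleigh_width_sq_le` — `(R^f_i − R^f_{i′})² ≤ 32·l₀²·y² + 2·(l₀/m₀)²·(R^o_i − R^o_{i′})²` for `E = e^y`, `0 ≤ y ≤ 1`, given both (A5) pairs.

HONEST FRAMING: elementary inequalities; `stub_liftLeakage` stays OPEN; nothing here bears on infinite volume, the continuum limit or the Clay gap.
References: T. Kato, J. Phys. Soc. Japan 4 (1949) 334 [cite: Kato1949, §1]; M. Lüscher, NPB 219 (1983) 233 [cite: Luscher1983, §3].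
-/

set_option autoImplicit false

noncomputable section

open MeasureTheory Filter Topology
open Literature.MathematicalPhysics.QuantumFieldTheory
open Literature.MathematicalPhysics.QuantumLattice
open scoped BigOperators

namespace Summit.QuantumFields.YangMills.Theorems.FemtoTransferGap.LiftLeak

/-! ## §1 Residual laws transfer to the Rayleigh quotient -/

section Femto

variable {L : ℕ} [NeZero L]

/-- ★ **A residual law at any `a` gives the residual law at the Rayleigh quotient** (physical `v`; if `‖v‖² = 0` then `K_βv` is null too).
[cite: Kato1949, §1] -/
theorem residual_at_rayleigh_le (β : ℝ) {v : GaugeConfig 3 L SU2 → ℝ} (hv : IsPhys v) {a ρ : ℝ}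
    (h : l2 (transferApply β v - a • v) (transferApply β v - a • v) ≤ ρ * l2 v v) :
    l2 (transferApply β v - (l2 v (transferApply β v) / l2 v v) • v) (transferApply β v - (l2 v (transferApply β v) / l2 v v) • v) ≤
      ρ * l2 v v := by
  rcases (l2_self_nonneg v).eq_or_lt with h0 | hpos
  · -- null vector: `‖K_βv‖² = ⟨v, K_β(K_βv)⟩ ≤ ‖v‖·‖K_βK_βv‖ = 0`
    have hKv : IsPhys (transferApply β v) := isPhys_transferApply β hv
    have hKKv : IsPhys (transferApply β (transferApply β v)) := isPhys_transferApply β hKv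
    have hcs := sq_l2_le hv hKKv
    rw [← h0, zero_mul] at hcs
    have hz : l2 v (transferApply β (transferApply β v)) = 0 := pow_eq_zero_iff two_ne_zero |>.mp (le_antisymm hcs (sq_nonneg _))
    have hKK : l2 (transferApply β v) (transferApply β v) = 0 := by rw [l2_transferApply_comm β hv hKv, hz]
    rw [← h0, div_zero, zero_smul, sub_zero, hKK, mul_zero]
  · exact residual_le_of_leakage β hv hpos (leakage_of_residual β hv h)

end Femto

/-! ## §2 Rayleigh gaps from ratio universality -/

section Real

/-- **One-sided Rayleigh gap from the (A5) pair «upper for `i`, lower for `i′`»**: with `E ≥ 1`, `m₀ > 0`, `l₀ ≥ 0`, `R^o_i ≤ m₀`,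
`R^f_i·m₀ ≤ E·R^o_i·l₀` and `R^o_{i′}·l₀ ≤ E·R^f_{i′}·m₀` give `R^f_i − R^f_{i′} ≤ l₀(E − E⁻¹) + (l₀/m₀)|R^o_i − R^o_{i′}|`. [folklore] -/
theorem ratio_gap_le {RF RF' RO RO' l0 m0 E : ℝ} (hm0 : 0 < m0) (hl0 : 0 ≤ l0) (hE : 1 ≤ E) (hROm : RO ≤ m0)
    (hup : RF * m0 ≤ E * (RO * l0)) (hlow : RO' * l0 ≤ E * (RF' * m0)) :
    RF - RF' ≤ l0 * (E - E⁻¹) + l0 / m0 * |RO - RO'| := by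
  have hEpos : 0 < E := lt_of_lt_of_le one_pos hE
  have hEinv : E⁻¹ ≤ 1 := inv_le_one_of_one_le₀ hE
  have hEinv0 : 0 ≤ E⁻¹ := inv_nonneg.mpr hEpos.le
  -- `RF ≤ E·RO·l0/m0` and `RF' ≥ RO'·l0/(E·m0)`
  have h1 : RF ≤ E * RO * (l0 / m0) := by
    rw [show E * RO * (l0 / m0) = E * (RO * l0) / m0 by ring, le_div_iff₀ hm0]; exact hup
  have h2 : E⁻¹ * RO' * (l0 / m0) ≤ RF' := by
    rw [show E⁻¹ * RO' * (l0 / m0) = RO' * l0 / (E * m0) by field_simp, div_le_iff₀ (mul_pos hEpos hm0)]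
    linarith
  -- `E·RO − E⁻¹·RO' = (E − E⁻¹)·RO + E⁻¹·(RO − RO') ≤ (E − E⁻¹)·m0 + |RO − RO'|`
  have hEE : 0 ≤ E - E⁻¹ := by linarith
  have h3 : E * RO - E⁻¹ * RO' ≤ (E - E⁻¹) * m0 + |RO - RO'| := by
    have h31 : (E - E⁻¹) * RO ≤ (E - E⁻¹) * m0 := mul_le_mul_of_nonneg_left hROm hEE
    have h32 : E⁻¹ * (RO - RO') ≤ |RO - RO'| :=
      (mul_le_mul_of_nonneg_left (le_abs_self _) hEinv0).trans (mul_le_of_le_one_left (abs_nonneg _) hEinv)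
    nlinarith
  have hlm : 0 ≤ l0 / m0 := div_nonneg hl0 hm0.le
  calc RF - RF' ≤ E * RO * (l0 / m0) - E⁻¹ * RO' * (l0 / m0) := by linarith
    _ = (l0 / m0) * (E * RO - E⁻¹ * RO') := by ring
    _ ≤ (l0 / m0) * ((E - E⁻¹) * m0 + |RO - RO'|) := mul_le_mul_of_nonneg_left h3 hlm
    _ = l0 * (E - E⁻¹) + l0 / m0 * |RO - RO'| := by field_simp

/-- **Ratio forms of the (A5) product inequalities** (`n_f, n_o > 0`):
`d_f n_o m₀ ≤ E d_o n_f l₀` and `d_o n_f l₀ ≤ E d_f n_o m₀` give `(d_f/n_f) m₀ ≤ E (d_o/n_o) l₀` and `(d_o/n_o) l₀ ≤ E (d_f/n_f) m₀`. [folklore] -/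
theorem ratio_forms_of_products {dF nF dO nO l0 m0 E : ℝ} (hnF : 0 < nF) (hnO : 0 < nO)
    (a1 : dF * nO * m0 ≤ E * (dO * nF * l0)) (a2 : dO * nF * l0 ≤ E * (dF * nO * m0)) :
    dF / nF * m0 ≤ E * (dO / nO * l0) ∧ dO / nO * l0 ≤ E * (dF / nF * m0) := by
  constructor
  · rw [div_mul_eq_mul_div, div_le_iff₀ hnF, show E * (dO / nO * l0) * nF = E * (dO * nF * l0) / nO by field_simp,
      le_div_iff₀ hnO]
    calc dF * m0 * nO = dF * nO * m0 := by ring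
      _ ≤ _ := a1
  · rw [div_mul_eq_mul_div, div_le_iff₀ hnO, show E * (dF / nF * m0) * nO = E * (dF * nO * m0) / nF by field_simp,
      le_div_iff₀ hnF]
    calc dO * l0 * nF = dO * nF * l0 := by ring
      _ ≤ _ := a2

/-- `e^y − e^{−y} ≤ 4y` for `0 ≤ y ≤ 1`. [folklore] -/
theorem exp_sub_exp_neg_le_four_mul {y : ℝ} (hy0 : 0 ≤ y) (hy1 : y ≤ 1) : Real.exp y - Real.exp (-y) ≤ 4 * y := by
  have ha : |y| ≤ 1 := by rw [abs_of_nonneg hy0]; exact hy1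
  have hb : |-y| ≤ 1 := by rw [abs_neg]; exact ha
  have h1 := Real.abs_exp_sub_one_le ha
  have h2 := Real.abs_exp_sub_one_le hb
  rw [abs_of_nonneg hy0] at h1
  rw [abs_neg, abs_of_nonneg hy0] at h2
  have h1' := (le_abs_self _).trans h1
  have h2' := (neg_le_abs _).trans h2
  linarith

/-- ★ **Squared Rayleigh gap inside a one-site level from BOTH (A5) pairs**: with `E = e^y`, `0 ≤ y ≤ 1`, `m₀ > 0`, `l₀ ≥ 0`, `R^o_i, R^o_{i′} ≤ m₀`:
`(R^f_i − R^f_{i′})² ≤ 32·l₀²·y² + 2·(l₀/m₀)²·(R^o_i − R^o_{i′})²`. [cite: Luscher1983, §3] -/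
theorem rayleigh_width_sq_le {RF RF' RO RO' l0 m0 y : ℝ} (hm0 : 0 < m0) (hl0 : 0 ≤ l0) (hy0 : 0 ≤ y) (hy1 : y ≤ 1)
    (hROm : RO ≤ m0) (hRO'm : RO' ≤ m0)
    (hup : RF * m0 ≤ Real.exp y * (RO * l0)) (hlow : RO * l0 ≤ Real.exp y * (RF * m0))
    (hup' : RF' * m0 ≤ Real.exp y * (RO' * l0)) (hlow' : RO' * l0 ≤ Real.exp y * (RF' * m0)) :
    (RF - RF') ^ 2 ≤ 32 * l0 ^ 2 * y ^ 2 + 2 * (l0 / m0) ^ 2 * (RO - RO') ^ 2 := by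
  have hE : 1 ≤ Real.exp y := by simpa using Real.one_le_exp hy0
  have hEE : Real.exp y - (Real.exp y)⁻¹ ≤ 4 * y := by rw [← Real.exp_neg]; exact exp_sub_exp_neg_le_four_mul hy0 hy1
  have hEE0 : 0 ≤ Real.exp y - (Real.exp y)⁻¹ := by linarith [inv_le_one_of_one_le₀ hE]
  have g1 := ratio_gap_le hm0 hl0 hE hROm hup hlow'
  have g2 := ratio_gap_le hm0 hl0 hE hRO'm hup' hlow
  rw [abs_sub_comm RO' RO] at g2
  set A := l0 * (Real.exp y - (Real.exp y)⁻¹) with hA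
  set B := l0 / m0 * |RO - RO'| with hB
  have hA0 : 0 ≤ A := mul_nonneg hl0 hEE0
  have hB0 : 0 ≤ B := mul_nonneg (div_nonneg hl0 hm0.le) (abs_nonneg _)
  have habs : |RF - RF'| ≤ A + B := abs_sub_le_iff.mpr ⟨g1, by linarith⟩
  have hsq : (RF - RF') ^ 2 ≤ (A + B) ^ 2 := by
    rw [← sq_abs (RF - RF')]; exact pow_le_pow_left₀ (abs_nonneg _) habs 2
  have hA4 : A ≤ l0 * (4 * y) := mul_le_mul_of_nonneg_left hEE hl0
  have hA2 : A ^ 2 ≤ (l0 * (4 * y)) ^ 2 := pow_le_pow_left₀ hA0 hA4 2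
  have hB2 : B ^ 2 = (l0 / m0) ^ 2 * (RO - RO') ^ 2 := by rw [hB, mul_pow, sq_abs]
  nlinarith [sq_nonneg (A - B)]

end Real

end Summit.QuantumFields.YangMills.Theorems.FemtoTransferGap.LiftLeak

end
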